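import Summits.ValiantsHypothesis.ValiantsHypothesis.Theorems.TwoAdicLadderTwoIntegralNormalisationScaledHalfElim
import Literature.Computability.AlgebraicComplexity.RealTauConjectureDepthFour
import Literature.Computability.AlgebraicComplexity.RazElusiveGeneralRouteProofs
import Literature.Computability.AlgebraicComplexity.ValiantConjectureEquivProofs
import Mathlib.NumberTheory.NumberField.InfinitePlace.Embeddings

/-!
# TwoAdicLadder — crux `TwoIntegralNormalisation` (stmt-ValiantsHypothesis-5947), line `birth`,
# stub `stub_halfElim`: THE GLOBAL FORM IS IMPLIED BY `TauConstElim` (route TauConst, item 0335)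

Calibration of the proposed replacement `HalfElimGlobal` of the open stub `stub_halfElim` (crux
workfiles `HALFELIM-CENSUS.md`, `PROPOSED_LINE_global.lean`): it is implied by the crux
`TauConstElim` of route `TauConst` (stmt-ValiantsHypothesis-0335, "`VP_ℂ = VNP_ℂ →` the
constant-free complexity `τ(per_n)` is p-bounded", a HELD named open problem), whose statement is
taken here verbatim as a hypothesis (no import of another route file):

* `halfElimGlobal_of_tauConstElim` — polynomial number-field circuits for `per` put `per` in `VP_ℂ`
  (embedding `K ↪ ℂ`, as in `isPComputable_perPoly_complex_of_numberField`), hence `VP_ℂ = VNP_ℂ`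
  (tree `isPComputable_perPoly_complex_iff`), hence `τ(per_n) ≤ n^c + c`, and a constant-free
  circuit is a circuit over the local ring `ℤ_(2) = Localization.AtPrime 𝔭` of `𝓞 ℚ`, `𝔭 ∋ 2`
  (tree `complexity_map_le_constantFreeComplexity`, `map_perPoly`).

So, in strength: `VH ⟹ HalfElimGlobal ⟸ TauConstElim`, and `HalfElimGlobal ⟹ TwoIntegralNormalisation`
(`twoIntegralNormalisation_of_halfElimGlobal'`). Honest framing: calibration only; nothing here proves
`stub_halfElim`, `TauConstElim`, the crux or VP ≠ VNP.
-/

noncomputable section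

open MvPolynomial

-- the summit and the problem share the name `ValiantsHypothesis` (D-0017 single-conjunct layout)
set_option linter.dupNamespace false

namespace Summit.ValiantsHypothesis.ValiantsHypothesis.Theorems.TwoAdicLadder.TwoIntegralNormalisation

open NumberField Literature.Computability.AlgebraicComplexity

/-- **`TauConstElim → HalfElimGlobal`.** Hypothesis `hτ` is the statement of route TauConst's crux
`TauConstElim` (stmt-ValiantsHypothesis-0335) verbatim. If `per` has polynomial circuits over number
fields then `VP_ℂ = VNP_ℂ`, so `τ(per_n) ≤ n^c + c`, and the constant-free circuits map to the
local ring `Localization.AtPrime 𝔭` of `𝓞 ℚ` at a prime `𝔭 ∋ 2`. [cite: Burgisser2000, §4.1] -/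
theorem halfElimGlobal_of_tauConstElim
    (hτ : VP ℂ = VNP ℂ → IsPBounded (fun n => constantFreeComplexity (perPoly (Fin n) ℤ))) :
    (∃ a : ℕ, ∀ n : ℕ, ∃ (K : Type) (_ : Field K) (_ : NumberField K),
        complexity (perPoly (Fin n) K) ≤ n ^ a + a) →
      ∃ b : ℕ, ∀ᶠ n in Filter.atTop, ∃ (K' : Type) (_ : Field K') (_ : NumberField K')
        (P : Ideal (NumberField.RingOfIntegers K')) (_ : P.IsPrime),
        (2 : NumberField.RingOfIntegers K') ∈ P ∧
        complexity (perPoly (Fin n) (Localization.AtPrime P)) ≤ n ^ b := by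
  rintro ⟨a, ha⟩
  -- polynomial number-field circuits put `per` in `VP_ℂ` (embed `K ↪ ℂ`, extension of scalars is free)
  have hP : IsPComputable (fun n => perPoly (Fin n) ℂ) := by
    refine ⟨a, fun n => ?_⟩
    obtain ⟨K, hFK, hNK, hK⟩ := ha n
    obtain ⟨φ⟩ := (inferInstance : Nonempty (K →+* ℂ))
    have hmap := ArithCircuit.complexity_map_le φ (perPoly (Fin n) K)
    rw [map_perPoly] at hmap
    exact hmap.trans hK
  obtain ⟨c, hc⟩ := hτ (isPComputable_perPoly_complex_iff.1 hP)
  obtain ⟨P, hP2, h2⟩ := exists_isPrime_two_mem ℚ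
  refine ⟨c + 1, ?_⟩
  filter_upwards [Filter.eventually_ge_atTop 2] with n hn
  refine ⟨ℚ, inferInstance, inferInstance, P, hP2, h2, ?_⟩
  have hmap := ArithCircuit.complexity_map_le_constantFreeComplexity
    (Int.castRingHom (Localization.AtPrime P)) (perPoly (Fin n) ℤ)
  rw [map_perPoly] at hmap
  refine hmap.trans ((hc n).trans ?_)
  -- `n^c + c ≤ n^(c+1)` for `n ≥ 2`
  have h1 : c ≤ n ^ c := (c.lt_two_pow_self).le.trans (Nat.pow_le_pow_left hn c)
  calc n ^ c + c ≤ n ^ c + n ^ c := by omega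
    _ = 2 * n ^ c := by ring
    _ ≤ n * n ^ c := Nat.mul_le_mul_right _ hn
    _ = n ^ (c + 1) := by ring

end Summit.ValiantsHypothesis.ValiantsHypothesis.Theorems.TwoAdicLadder.TwoIntegralNormalisation

end
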